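import Literature.NumberTheory.EllipticCurves.TateNormalFormUnramifiedComponentsProofs
import HarnessLib

/-!
# The component homomorphism `E(K_v^nr) → ℤ/c` of a Tate normal form over `K̄_v`:
# kernel `E₀`, trivial Galois action (Silverman *ATAEC* IV.9.2 (d); Matsuno 2009, Lemma 4.1)

`Proofs` file (theorems only, no definitions, no named facts) in topic `NumberTheory/EllipticCurves`.
Sequel of `TateNormalFormUnramifiedComponentsProofs`, on the same carrier: `K` a number field, `v` a finite
place, `K_v` its completion with integers `𝓞_v`, `K̄_v` an algebraic closure with the spectral valuation
`w` (`hw`), `Γ_{K_v}` acting on `V(K̄_v)`, `V = (J ⊗ K_v) ⊗ K̄_v`, through `absoluteGaloisGroup.toAlgEquiv`,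
`𝔐` a prime of the local absolute integers `\bar 𝓞_v` above `𝓂_v` with inertia group `I_𝔐` (fixed field
`K_v^nr`), `E₀` = the points `P` with `ReducesToNonsingular w (residue 𝒪_w) P`, and `J : y² + xy = x³ + αϖᶜ`
a Tate normal form over `𝓞_v` (`α ∈ 𝓞_vˣ`, `ϖ` a uniformiser, `c ≥ 1`).

`exists_rational_generator_of_tateNormalForm` (that file) says: there is a `Γ_{K_v}`-fixed `g ∈ V(K̄_v)` with
`i • g ∈ E₀ ↔ c ∣ i` such that every `I_𝔐`-fixed point `P` has `P − i • g ∈ E₀` for some `i < c`.  This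
file turns that into the **component homomorphism** of Tate's algorithm / the Tate curve
(Silverman, *ATAEC*, Cor. IV.9.2 (d): `E(K)/E₀(K) ≅ ℤ/ord_v(Δ)` for split multiplicative reduction; on
`E_q(L) = L^×/q^ℤ` it is `u ↦ ord(u) mod ord(q)`, visibly invariant under `Gal(L/K_v)`):

* `eq_of_mem_localPrimesAbove` — there is only one prime of `\bar 𝓞_v` above `𝓂_v` (both are
  `{|·|_v < 1}`, `mem_iff_spectralValuation_lt_one`); so "fixed by `I_𝔐`" does not depend on `𝔐`.
* `exists_componentHom_of_tateNormalForm` (**main**): there are a subgroup `Dom ≤ V(K̄_v)` and an additive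
  `comp : Dom →+ ZMod c` such that (1) every point fixed by the inertia group of ANY prime above `𝓂_v`
  lies in `Dom` (so `E(K_v^nr) ≤ Dom`), (2) `E₀ ≤ Dom`, (3) for `P ∈ Dom`: `comp P = 0 ↔ P ∈ E₀`,
  (4) `Dom` is `Γ_{K_v}`-stable and `comp (σ P) = comp P` for every `σ ∈ Γ_{K_v}` — the TRIVIALITY of the
  Galois action on the component group `E(K_v^nr)/E₀(K_v^nr)` as an identity of VALUES, not only of
  classes (Matsuno 2009, proof of Lemma 4.1: "`G₀` acts trivially on `E(L)/E₀(L) ≅ ℤ/c_ℓ`") —, and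
  (5) `comp g = 1` on a `Γ_{K_v}`-fixed `g ∈ Dom` (so `comp` is onto).
  `Dom` is `E₀ + ℤg` and `comp (y + k g) = k mod c`; well defined because `k • g ∈ E₀ ↔ c ∣ k`.

Use (cell `bsd-stepL`, crux item stmt-BirchSwinnertonDyer-19715, ideator line `aux_norm_receptacle`, stub S1
`TateComponentFamily`): composed with the transport `E(K̄_v) ≃ V(K̄_v)` to the Tate normal form of the minimal
model and with the maps `E(K[n]) → E(K̄_v)` of the ring class fields (unramified at `v ∤ n`, so landing in
`E(K_v^nr)`), `comp` is the Tate component character of that stub; (4) is its Galois covariance.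

## References

* [SilvermanATAEC1994] J. H. Silverman, *Advanced Topics in the Arithmetic of Elliptic Curves*, GTM 151
  (1994), Cor. IV.9.2 (d) (PDF p. 340), Rem. IV.9.6, V.4 Lemmas 4.1.1–4.1.4.
* [Matsuno2009] K. Matsuno, Math. Res. Lett. 16 (2009), proof of Lemma 4.1 (p. 454).
* [SilvermanAEC2009] J. H. Silverman, *The Arithmetic of Elliptic Curves*, 2nd ed. (2009), VII.2.1 (`E₀` is a
  subgroup), VII.6.1.

## Design

No definitions; `Dom` and `comp` are produced existentially (built in the proof from the rational generator
`g`: `Dom = {P | ∃ k : ℤ, P − k • g ∈ E₀}`, `comp P = k mod c`).  `E₀` is handled as the pull-back of the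
tree's `nonsingularReductionSubgroup` of the `𝒪_w`-model `J ⊗ 𝒪_w` (as in
`reducesToNonsingular_map_sub_of_tateNormalForm`).  One universe `u`; `noncomputable section`;
`open scoped Classical NNReal`.  Axioms: `propext`, `Classical.choice`, `Quot.sound`.

presearch: the statement is Silverman ATAEC IV.9.2 (d) + the Galois-invariance sentence of Matsuno L4.1;
`lean search 'componentHom|component.*ZMod.*tateNormalForm'` → only `LocalIndex.exists_addMonoidHom_zmod_of_tateNormalForm`
(one Henselian field, values by shape) and `exists_rational_generator_of_tateNormalForm` (classes); no
`K̄_v`-level homomorphism with Galois invariance.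
-/

noncomputable section

open scoped Classical NNReal
open NumberField IsDedekindDomain Field IsLocalRing

universe u

namespace IsDedekindDomain.HeightOneSpectrum

open Literature.NumberTheory.EllipticCurves Literature.NumberTheory.GaloisRepresentations

variable {K : Type u} [Field K] [NumberField K] {v : HeightOneSpectrum (𝓞 K)}

/-- **There is exactly one prime of `\bar 𝓞_v` above `𝓂_v`** (`K_v` is complete, so its valuation extends
uniquely to `K̄_v`): any two members of `v.localPrimesAbove` coincide, both being `{b : |b|_v < 1}` for the
spectral valuation (`mem_iff_spectralValuation_lt_one`): Neukirch, *ANT*, Ch. II Thm. (4.8) (uniqueness of the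
extension of a complete valuation) with (6.2) and (8.1). [cite: NeukirchANT1999, Ch. II Thm. (4.8) and (8.1)] -/
theorem eq_of_mem_localPrimesAbove {𝔐 𝔐' : Ideal v.localAbsIntegers} (h𝔐 : 𝔐 ∈ v.localPrimesAbove)
    (h𝔐' : 𝔐' ∈ v.localPrimesAbove) : 𝔐 = 𝔐' := by
  obtain ⟨w, hw⟩ := v.exists_spectralValuation
  ext b
  rw [mem_iff_spectralValuation_lt_one hw h𝔐, mem_iff_spectralValuation_lt_one hw h𝔐']

variable {w : Valuation (AlgebraicClosure (v.adicCompletion K)) ℝ≥0}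
  (hw : ∀ x, (w x : ℝ) = spectralNorm (v.adicCompletion K) (AlgebraicClosure (v.adicCompletion K)) x)

include hw in
/-- **`E₀ ≤ V(K̄_v)` as a subgroup, for an `𝓞_v`-equation.** For `J` over `𝓞_v` and `V = (J ⊗ K_v) ⊗ K̄_v`
the points `P` with `ReducesToNonsingular w (residue 𝒪_w) P` form a subgroup of `V(K̄_v)` (Silverman *AEC*
VII.2.1, through the `𝒪_w`-model `J ⊗ 𝒪_w` and the tree's `nonsingularReductionSubgroup`).
[cite: SilvermanAEC2009, VII.2 Prop. 2.1] -/
theorem exists_addSubgroup_iff_reducesToNonsingular (J : WeierstrassCurve (v.adicCompletionIntegers K)) :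
    ∃ E0 : AddSubgroup ((J.baseChange (v.adicCompletion K)).baseChange
        (AlgebraicClosure (v.adicCompletion K))).toAffine.Point,
      ∀ P, P ∈ E0 ↔ ReducesToNonsingular w (IsLocalRing.residue w.integer) P := by
  obtain ⟨φ, hφ⟩ := exists_ringHom_adicCompletionIntegers_unrIntegers hw
  obtain ⟨ψ, hψ⟩ := exists_ringHom_unrIntegers_integer (w := w) (v := v) (K := K)
  set θ : v.adicCompletionIntegers K →+* w.integer := ψ.comp φ with hθdef
  have hθ : ∀ a, ((θ a : w.integer) : AlgebraicClosure (v.adicCompletion K)) =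
      algebraMap (v.adicCompletion K) (AlgebraicClosure (v.adicCompletion K)) a := fun a ↦ by
    rw [hθdef, RingHom.comp_apply, hψ, hφ]
  have hW₀ : (J.map θ).baseChange (AlgebraicClosure (v.adicCompletion K)) =
      (J.baseChange (v.adicCompletion K)).baseChange (AlgebraicClosure (v.adicCompletion K)) := by
    change (J.map θ).map (algebraMap _ _) = (J.map (algebraMap _ _)).map (algebraMap _ _)
    rw [WeierstrassCurve.map_map, WeierstrassCurve.map_map]
    congr 1
    exact RingHom.ext fun a ↦ hθ a
  refine ⟨((J.map θ).nonsingularReductionSubgroup (Valuation.integer.integers w)).comap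
      (WeierstrassCurve.Affine.Point.congrEquiv hW₀.symm).toAddMonoidHom, fun P ↦ ?_⟩
  rw [AddSubgroup.mem_comap, WeierstrassCurve.mem_nonsingularReductionSubgroup_iff,
    ← reducesToNonsingular_iff_hasNonsingularReduction]
  exact reducesToNonsingular_congrEquiv_iff (w := w) (r := IsLocalRing.residue w.integer) (h := hW₀.symm) (P := P)

include hw in
/-- **The component homomorphism of a Tate normal form over `K̄_v`** (Silverman, *ATAEC*, Cor. IV.9.2 (d);
Matsuno 2009, proof of Lemma 4.1).  For `J : y² + xy = x³ + αϖᶜ` over `𝓞_v` (`α` a unit, `ϖ` a uniformiser,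
`c ≥ 1`) and `V = (J ⊗ K_v) ⊗ K̄_v` there are a subgroup `Dom ≤ V(K̄_v)` and an additive map
`comp : Dom →+ ℤ/c` such that:
(1) every point fixed by the inertia group `I_𝔐` of any prime `𝔐` of `\bar 𝓞_v` above `𝓂_v` lies in `Dom`
(`E(K_v^nr) ≤ Dom`); (2) `E₀ ≤ Dom`; (3) for `P ∈ Dom`, `comp P = 0 ↔ P ∈ E₀` (nonsingular reduction for the
spectral valuation); (4) for `σ ∈ Γ_{K_v}` and `P ∈ Dom`: `σ P ∈ Dom` and `comp (σ P) = comp P` (the Galois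
group acts trivially on the component group — as VALUES); (5) there is a `Γ_{K_v}`-fixed `g ∈ Dom` with
`comp g = 1`.  Hence `comp` induces `E(K_v^nr)/E₀(K_v^nr) ≅ ℤ/c`, `Γ_{K_v}`-equivariantly for the trivial
action. Built from `exists_rational_generator_of_tateNormalForm`: `Dom = E₀ + ℤ g`, `comp (y + k g) = k`.
[cite: SilvermanATAEC1994, Cor. IV.9.2 (d) (PDF p. 340)] [cite: Matsuno2009, Lemma 4.1 (proof, p. 454)] -/
theorem exists_componentHom_of_tateNormalForm (J : WeierstrassCurve (v.adicCompletionIntegers K))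
    {ϖ α : v.adicCompletionIntegers K} {c : ℕ} (hϖ : Irreducible ϖ) (h1 : J.a₁ = 1)
    (h2 : J.a₂ = 0) (h3 : J.a₃ = 0) (h4 : J.a₄ = 0) (hα : IsUnit α) (hc : 1 ≤ c)
    (h6 : J.a₆ = α * ϖ ^ c) :
    ∃ (Dom : AddSubgroup ((J.baseChange (v.adicCompletion K)).baseChange
        (AlgebraicClosure (v.adicCompletion K))).toAffine.Point) (comp : Dom →+ ZMod c),
      (∀ {𝔐 : Ideal v.localAbsIntegers}, 𝔐 ∈ v.localPrimesAbove →
        ∀ P : ((J.baseChange (v.adicCompletion K)).baseChange (AlgebraicClosure (v.adicCompletion K))).toAffine.Point,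
          (∀ τ ∈ 𝔐.inertia (absoluteGaloisGroup (v.adicCompletion K)),
            WeierstrassCurve.Affine.Point.map ((absoluteGaloisGroup.toAlgEquiv _ τ :
              AlgebraicClosure (v.adicCompletion K) ≃ₐ[v.adicCompletion K] AlgebraicClosure (v.adicCompletion K)) :
              AlgebraicClosure (v.adicCompletion K) →ₐ[v.adicCompletion K] AlgebraicClosure (v.adicCompletion K)) P = P) →
          P ∈ Dom) ∧
      (∀ P, ReducesToNonsingular w (IsLocalRing.residue w.integer) P → P ∈ Dom) ∧
      (∀ P (hP : P ∈ Dom), comp ⟨P, hP⟩ = 0 ↔ ReducesToNonsingular w (IsLocalRing.residue w.integer) P) ∧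
      (∀ (σ : absoluteGaloisGroup (v.adicCompletion K)) (P) (hP : P ∈ Dom),
        ∃ hσP : WeierstrassCurve.Affine.Point.map ((absoluteGaloisGroup.toAlgEquiv _ σ :
              AlgebraicClosure (v.adicCompletion K) ≃ₐ[v.adicCompletion K] AlgebraicClosure (v.adicCompletion K)) :
              AlgebraicClosure (v.adicCompletion K) →ₐ[v.adicCompletion K] AlgebraicClosure (v.adicCompletion K)) P ∈ Dom,
          comp ⟨_, hσP⟩ = comp ⟨P, hP⟩) ∧
      (∃ (g : ((J.baseChange (v.adicCompletion K)).baseChange (AlgebraicClosure (v.adicCompletion K))).toAffine.Point)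
          (hg : g ∈ Dom),
        (∀ σ : absoluteGaloisGroup (v.adicCompletion K),
          WeierstrassCurve.Affine.Point.map ((absoluteGaloisGroup.toAlgEquiv _ σ :
            AlgebraicClosure (v.adicCompletion K) ≃ₐ[v.adicCompletion K] AlgebraicClosure (v.adicCompletion K)) :
            AlgebraicClosure (v.adicCompletion K) →ₐ[v.adicCompletion K] AlgebraicClosure (v.adicCompletion K)) g = g) ∧
        comp ⟨g, hg⟩ = 1) := by
  -- `E₀` as a subgroup, and an `𝒪_w`-model of `V` (for the Galois stability of `E₀`)
  obtain ⟨E0, hE0⟩ := exists_addSubgroup_iff_reducesToNonsingular hw J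
  obtain ⟨φ, hφ⟩ := exists_ringHom_adicCompletionIntegers_unrIntegers hw
  obtain ⟨ψ, hψ⟩ := exists_ringHom_unrIntegers_integer (w := w) (v := v) (K := K)
  set θ : v.adicCompletionIntegers K →+* w.integer := ψ.comp φ with hθdef
  have hθ : ∀ a, ((θ a : w.integer) : AlgebraicClosure (v.adicCompletion K)) =
      algebraMap (v.adicCompletion K) (AlgebraicClosure (v.adicCompletion K)) a := fun a ↦ by
    rw [hθdef, RingHom.comp_apply, hψ, hφ]
  have hW₀ : (J.map θ).baseChange (AlgebraicClosure (v.adicCompletion K)) =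
      (J.baseChange (v.adicCompletion K)).baseChange (AlgebraicClosure (v.adicCompletion K)) := by
    change (J.map θ).map (algebraMap _ _) = (J.map (algebraMap _ _)).map (algebraMap _ _)
    rw [WeierstrassCurve.map_map, WeierstrassCurve.map_map]
    congr 1
    exact RingHom.ext fun a ↦ hθ a
  haveI : ((J.baseChange (v.adicCompletion K)).baseChange (AlgebraicClosure (v.adicCompletion K))).IsIntegral
      w.integer := ⟨J.map θ, hW₀.symm⟩
  -- Galois stability of `E₀`
  have hE0σ : ∀ (σ : absoluteGaloisGroup (v.adicCompletion K)) (P), P ∈ E0 →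
      WeierstrassCurve.Affine.Point.map ((absoluteGaloisGroup.toAlgEquiv _ σ :
        AlgebraicClosure (v.adicCompletion K) ≃ₐ[v.adicCompletion K] AlgebraicClosure (v.adicCompletion K)) :
        AlgebraicClosure (v.adicCompletion K) →ₐ[v.adicCompletion K] AlgebraicClosure (v.adicCompletion K)) P ∈ E0 := by
    intro σ P hP
    rw [hE0] at hP ⊢
    exact (reducesToNonsingular_map_iff_of_forall_eq (J.baseChange (v.adicCompletion K)) _
      (fun z ↦ spectralValuation_smul hw σ z) P).mpr hP
  -- the rational generator
  obtain ⟨𝔐₀, h𝔐₀⟩ := localPrimesAbove_nonempty (v := v)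
  obtain ⟨g, hgσ, hga, hgc⟩ := exists_rational_generator_of_tateNormalForm hw h𝔐₀ J hϖ h1 h2 h3 h4 hα hc h6
  -- `k • g ∈ E₀ ↔ c ∣ k`, for integers `k`
  have hgaZ : ∀ k : ℤ, k • g ∈ E0 ↔ (c : ℤ) ∣ k := by
    intro k
    obtain ⟨n, rfl | rfl⟩ := Int.eq_nat_or_neg k
    · rw [natCast_zsmul, hE0, hga n, Int.natCast_dvd_natCast]
    · rw [neg_zsmul, natCast_zsmul, E0.neg_mem_iff, hE0, hga n, dvd_neg, Int.natCast_dvd_natCast]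
  -- the domain `E₀ + ℤ g`
  let Dom : AddSubgroup ((J.baseChange (v.adicCompletion K)).baseChange
      (AlgebraicClosure (v.adicCompletion K))).toAffine.Point :=
    { carrier := {P | ∃ k : ℤ, P - k • g ∈ E0}
      zero_mem' := ⟨0, by rw [zero_zsmul, sub_zero]; exact E0.zero_mem⟩
      add_mem' := by
        rintro P Q ⟨k, hk⟩ ⟨k', hk'⟩
        refine ⟨k + k', ?_⟩
        have e : P + Q - (k + k') • g = (P - k • g) + (Q - k' • g) := by rw [add_zsmul]; abel
        rw [e]
        exact E0.add_mem hk hk'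
      neg_mem' := by
        rintro P ⟨k, hk⟩
        refine ⟨-k, ?_⟩
        have e : -P - (-k) • g = -(P - k • g) := by rw [neg_zsmul]; abel
        rw [e]
        exact E0.neg_mem hk }
  have hDom : ∀ P, P ∈ Dom ↔ ∃ k : ℤ, P - k • g ∈ E0 := fun P ↦ Iff.rfl
  -- the value `k mod c` is well defined on `Dom`
  let f : ((J.baseChange (v.adicCompletion K)).baseChange (AlgebraicClosure (v.adicCompletion K))).toAffine.Point →
      ZMod c := fun P ↦ if h : ∃ k : ℤ, P - k • g ∈ E0 then ((Classical.choose h : ℤ) : ZMod c) else 0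
  have hf : ∀ P (k : ℤ), P - k • g ∈ E0 → f P = (k : ZMod c) := by
    intro P k hk
    have h : ∃ k : ℤ, P - k • g ∈ E0 := ⟨k, hk⟩
    have hfP : f P = ((Classical.choose h : ℤ) : ZMod c) := dif_pos h
    rw [hfP, ZMod.intCast_eq_intCast_iff_dvd_sub, ← hgaZ]
    have e : (k - Classical.choose h) • g = (P - Classical.choose h • g) - (P - k • g) := by
      rw [sub_zsmul]; abel
    rw [e]
    exact E0.sub_mem (Classical.choose_spec h) hk
  let comp : Dom →+ ZMod c :=
    { toFun := fun P ↦ f P.1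
      map_zero' := by
        change f 0 = 0
        rw [hf 0 0 (by rw [zero_zsmul, sub_zero]; exact E0.zero_mem), Int.cast_zero]
      map_add' := by
        rintro ⟨P, ⟨k, hk⟩⟩ ⟨Q, ⟨k', hk'⟩⟩
        change f (P + Q) = f P + f Q
        have e : P + Q - (k + k') • g = (P - k • g) + (Q - k' • g) := by rw [add_zsmul]; abel
        rw [hf P k hk, hf Q k' hk', hf (P + Q) (k + k') (by rw [e]; exact E0.add_mem hk hk'),
          Int.cast_add] }
  have hcomp : ∀ P (hP : P ∈ Dom), comp ⟨P, hP⟩ = f P := fun _ _ ↦ rfl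
  refine ⟨Dom, comp, ?_, ?_, ?_, ?_, ?_⟩
  · -- (1) inertia-fixed points
    intro 𝔐 h𝔐 P hP
    have e𝔐 : 𝔐 = 𝔐₀ := eq_of_mem_localPrimesAbove h𝔐 h𝔐₀
    subst e𝔐
    obtain ⟨i, -, hi⟩ := hgc P hP
    exact ⟨i, by rw [natCast_zsmul, hE0]; exact hi⟩
  · -- (2) `E₀ ≤ Dom`
    intro P hP
    exact ⟨0, by rw [zero_zsmul, sub_zero, hE0]; exact hP⟩
  · -- (3) the kernel is `E₀`
    intro P hP
    obtain ⟨k, hk⟩ := hP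
    rw [hcomp, hf P k hk, ZMod.intCast_zmod_eq_zero_iff_dvd, ← hgaZ, ← hE0]
    constructor
    · intro h
      have e : P = (P - k • g) + k • g := by abel
      rw [e]
      exact E0.add_mem hk h
    · intro h
      have e : k • g = P - (P - k • g) := by abel
      rw [e]
      exact E0.sub_mem h hk
  · -- (4) Galois invariance
    intro σ P hP
    obtain ⟨k, hk⟩ := hP
    have hk' : WeierstrassCurve.Affine.Point.map ((absoluteGaloisGroup.toAlgEquiv _ σ :
          AlgebraicClosure (v.adicCompletion K) ≃ₐ[v.adicCompletion K] AlgebraicClosure (v.adicCompletion K)) :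
          AlgebraicClosure (v.adicCompletion K) →ₐ[v.adicCompletion K] AlgebraicClosure (v.adicCompletion K)) P -
        k • g ∈ E0 := by
      have e := hE0σ σ _ hk
      rwa [map_sub, map_zsmul, hgσ σ] at e
    exact ⟨⟨k, hk'⟩, by rw [hcomp, hcomp, hf _ k hk', hf P k hk]⟩
  · -- (5) the generator
    have hg1 : g - (1 : ℤ) • g ∈ E0 := by rw [one_zsmul, sub_self]; exact E0.zero_mem
    exact ⟨g, ⟨1, hg1⟩, hgσ, by rw [hcomp, hf g 1 hg1, Int.cast_one]⟩

end IsDedekindDomain.HeightOneSpectrum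

end
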